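import Summits.Ventures.GridStability.Bench.GFMSMIBDeg2AQoriaV4physVlevR5K1910v
import Summits.Ventures.GridStability.Lyapunov.CertificateSoundness
import Summits.Ventures.GridStability.Lyapunov.AngleRecovery
import Summits.Ventures.GridStability.Models.SMIB
import Mathlib.Analysis.Calculus.Deriv.Mul
import Mathlib.Analysis.Calculus.Deriv.Pow
import Mathlib.Analysis.Calculus.Deriv.Prod
import Mathlib.Analysis.Normed.Module.FiniteDimension
import Mathlib.Analysis.SpecialFunctions.Trigonometric.Deriv
import HarnessLib

/-!
# G3.a «GFM-SMIB-QoriaV4»-roa for the V-LEVER certificate `GFM-SMIB-deg2-A-QoriaV4phys-vlevR5K1910v` (deg 2, toolchain A recert, physical-time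
# reading; NEW `V` at level 1, declared ball `φ ≤ 5`, arc `κ ≤ 19/10`) — invariance, no pole slip, convergence FOR THE MODEL M′

Venture GRIDFUSION, `plan/PARTITION.md` A2 / A5″ / A6 / A19 (rung G3.a = the G1.SMIB pass on the droop grid-forming-inverter
instance); seat gridfusion-sos-5 (g9; instrument «V LEVER», memo §3.S2 «domain, then V»). The object: after the ARC LEVER
(★ #230, Bench/GFMSMIBDeg2AQoriaV4physK32{Data,,Roa,RoaModel,Lever}.lean: the day-1 degree-2 `V`, `κ ≤ 3/2`, level 55 → 83) the
ball / ball+arc lever on that `V` gives nothing (sos-5 g8: V̇ onset, ball exit and arc exit coincide within 1 % above 83), so the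
Lyapunov function ITSELF is re-synthesised on the declared domain `φ ≤ 5`, `κ ≤ 19/10` by a V–s alternation
(HOME/cert/sos-5/vlever/: S-step = toolchain-A multipliers for `V` fixed; V-step = one SDP linear in `V` with the
`(1 − V)`-multipliers frozen; float, UNTRUSTED) and RE-CERTIFIED exactly by toolchain A (claim instance → one max-margin SDP →
Peyrl–Parrilo rounding → exact LDLᵀ; kit job j309357): identities `V_pos` (`ε_pos = 1/10000`), `Vdot_neg` (`ε_dot = 1/200000`,
hypotheses `1 − V ≥ 0` and the declared domain `5 − φ ≥ 0`), `level_in_ball` (`φ ≤ 5` on the piece), `arc_excl` (`κ ≤ 19/10`),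
plus the inclusion identities `incl_record` (the ★ #230 piece `{V_rec ≤ 83} ∩ {φ ≤ 3} ∩ {h = 0}` lies inside `{V ≤ 1}`) and `shape_in`
(`{φ ≤ 21/20} ∩ {h = 0} ⊆ {V ≤ 1}`) read in the «…Lever» companion. This file is the «…Roa» companion, written on the TREE template
Bench/GFMSMIBDeg2AQoriaV4physK32Roa.lean (lyap-1's construction, sos-5 g7's arc-lever port): the Bench decls of
Bench/GFMSMIBDeg2AQoriaV4physVlevR5K1910v{Data,}.lean are used VERBATIM via their `_eq` lemmas (`deg2_A_QoriaV4phys_vlevR5K1910v_{f_sigma,f_kappa,f_omega,h,V,Vdot}_eq`)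
together with the CERTIFIED identities `deg2_A_QoriaV4phys_vlevR5K1910v_{Vdot_neg, level_in_ball, arc_excl}`; the analysis is
`Lyapunov/{SublevelTrapping, CertificateSoundness, AngleRecovery}.lean`; the original-coordinate model and the exact embedding are
model-1's `Models/SMIB.lean`; the hypothesis-free instances (model-1's `SMIB.gfmQoriaV4Phys`, model-3's droop model
`InverterDroop.gfmSmibQoriaV4` via the bridge `InverterBridgesSMIB`) are the sibling file `GFMSMIBDeg2AQoriaV4physVlevR5K1910vRoaModel.lean`.

THREE COLUMNS. CERTIFIED (kernel, in the Bench file): on `{h = 0}`: `V ≥ (1/10000)φ`; on `{h = 0} ∩ {V ≤ 1} ∩ {φ ≤ 5}`: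
`V̇ ≤ −(1/200000)φ`; on `{h = 0} ∩ {V ≤ 1}`: `φ ≤ 5` (so the domain hypothesis of `Vdot_neg` is discharged on the piece),
`κ ≤ 19/10`, with `φ = σ² + κ² + ω²/4500`. MODELLED: every theorem of THIS file is about an ODE — the recast polynomial system
`ż = F(z)` on `{h = 0} ⊂ ℝ³` (`deg2_A_QoriaV4phys_vlevR5K1910v_roa`) and model-1's classical SMIB model (`deg2_A_QoriaV4phys_vlevR5K1910v_smib_roa`) for ANY parameter
record `p : SMIB` and equilibrium angle `δs` satisfying the A1 data relations of the instance
(`P_M cos(δs−γ)/M = 233605208200/1873666673`, `P_M sin(δs−γ)/M = 29431488000/1873666673`, `D/M = 33`, `P_e(δs) = P_m`):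
M′ = reduced-order droop / VSM converter against an infinite bus ≡ classical SMIB with `M = 1/(k_i ω_c)`, `D = 1/k_i`
(MODEL-VALIDITY MV-6D+MV-P+MV-Ω(ω_b′ = 35500/113); inner loops, filter / line / dc-side dynamics, current limits, voltage
dynamics ABSENT). VALIDATED: nothing in this file (the alternation's float SDPs and the sampled geometry of the piece live in the
claim instance's `vlever` block / the Lever companion's docstring). No sentence of this file says a converter or a grid is stable;
«region of attraction» below means: the stated set of initial conditions OF THE MODEL M′ is carried to the model's synchronous
equilibrium.

STATEMENTS. `deg2_A_QoriaV4phys_vlevR5K1910v_roa`: for every `0 < γ ≤ 1` and every solution `z` of the recast system on `[0, ∞)` (Mathlib sense: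
continuous, right derivative `F (z t)`) with `h(z 0) = 0`, `V(z 0) ≤ γ`: `V(z t) ≤ γ` and `κ(t) ≤ 19/10` for all `t ≥ 0`, and
`z t → 0`. `deg2_A_QoriaV4phys_vlevR5K1910v_smib_roa`: for every solution `(δ, ω)` of the SMIB model `p` on `[0, ∞)` with `V(sin u₀, 1 − cos u₀, ω₀) ≤ γ`,
`|u₀| < π` (`u = δ − δs`): for all `t ≥ 0`, `V ≤ γ` along the recast state and `|u t| < π` (no pole slip), and
`(δ t, ω t) → (δs, 0)`. Obligations O1–O10 as in `TOYDeg2handRoa` (template): the domain `D = {φ ≤ 5}` is discharged on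
`{h = 0} ∩ {V ≤ 1}` by `level_in_ball`, `W = (1/200000)φ` is positive definite, compactness comes from `level_in_ball`
(`‖z‖∞ ≤ 150`), and the arc conjunct `κ ≤ 19/10` gives `cos u ≥ -9/10 > −1` for the angle recovery. Existence of the global
solution: `Literature.Analysis.ODE.exists_global_solution_of_sublevel` (lit-6) — not restated.
-/


namespace Summit.Ventures.GridStability.Bench.GFMSMIB

open Set Filter Metric Topology Real
open Summit.Ventures.GridStability.Lyapunov Summit.Ventures.GridStability.Models
open Literature.Computation.Certificates Literature.Computation.Certificates.SOS

noncomputable section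

/-! ### Recast phase space `Fin 3 → ℝ`, coordinates in the certificate's variable order ['sigma', 'kappa', 'omega'] -/

/-- The recast field of the instance on `Fin 3 → ℝ` (components = the Bench decls verbatim).
MODELLED column. [folklore] -/
def deg2_A_QoriaV4phys_vlevR5K1910v_F (z : Fin 3 → ℝ) : Fin 3 → ℝ :=
  ![deg2_A_QoriaV4phys_vlevR5K1910v_f_sigma (z 0) (z 1) (z 2),
    deg2_A_QoriaV4phys_vlevR5K1910v_f_kappa (z 0) (z 1) (z 2),
    deg2_A_QoriaV4phys_vlevR5K1910v_f_omega (z 0) (z 1) (z 2)]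

/-- The certificate's `V` on the phase space. [folklore] -/
def deg2_A_QoriaV4phys_vlevR5K1910v_Vz (z : Fin 3 → ℝ) : ℝ := deg2_A_QoriaV4phys_vlevR5K1910v_V (z 0) (z 1) (z 2)

/-- Its Lie derivative `∇V·f` (the emitted `Vdot`). [folklore] -/
def deg2_A_QoriaV4phys_vlevR5K1910v_LVz (z : Fin 3 → ℝ) : ℝ := deg2_A_QoriaV4phys_vlevR5K1910v_Vdot (z 0) (z 1) (z 2)

/-- The certified dissipation rate `W = ε_dot·φ`. [folklore] -/
def deg2_A_QoriaV4phys_vlevR5K1910v_Wz (z : Fin 3 → ℝ) : ℝ := ((1 : ℝ) / 200000) * ((1 : ℝ) * z 0 ^ 2 + (1 : ℝ) * z 1 ^ 2 + ((1 : ℝ) / 4500) * z 2 ^ 2)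

/-- The recast constraint set `M = {h_j = 0}`. [folklore] -/
def deg2_A_QoriaV4phys_vlevR5K1910v_M : Set (Fin 3 → ℝ) := {z | deg2_A_QoriaV4phys_vlevR5K1910v_h (z 0) (z 1) (z 2) = 0}

/-- The certificate's level `c = 1` (the V-LEVER object is emitted with its level normalised to 1). [folklore] -/
def deg2_A_QoriaV4phys_vlevR5K1910v_level : ℝ := (1 : ℝ)

/-- Component `0` (`sigma`) of the recast field. [folklore] -/
@[simp] theorem deg2_A_QoriaV4phys_vlevR5K1910v_F_0 (z : Fin 3 → ℝ) : deg2_A_QoriaV4phys_vlevR5K1910v_F z 0 = deg2_A_QoriaV4phys_vlevR5K1910v_f_sigma (z 0) (z 1) (z 2) := rfl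
/-- Component `1` (`kappa`) of the recast field. [folklore] -/
@[simp] theorem deg2_A_QoriaV4phys_vlevR5K1910v_F_1 (z : Fin 3 → ℝ) : deg2_A_QoriaV4phys_vlevR5K1910v_F z 1 = deg2_A_QoriaV4phys_vlevR5K1910v_f_kappa (z 0) (z 1) (z 2) := rfl
/-- Component `2` (`omega`) of the recast field. [folklore] -/
@[simp] theorem deg2_A_QoriaV4phys_vlevR5K1910v_F_2 (z : Fin 3 → ℝ) : deg2_A_QoriaV4phys_vlevR5K1910v_F z 2 = deg2_A_QoriaV4phys_vlevR5K1910v_f_omega (z 0) (z 1) (z 2) := rfl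

/-! ### Algebraic consequences of the certified identities -/

/-- Dissipation inequality in bridge form on `M ∩ {V ≤ c}`: `LV ≤ −W` (domain hypotheses of the
Bench theorem discharged by `level_in_ball`). CERTIFIED input: `deg2_A_QoriaV4phys_vlevR5K1910v_Vdot_neg`. [folklore] -/
theorem deg2_A_QoriaV4phys_vlevR5K1910v_LVz_le {z : Fin 3 → ℝ} (hz : z ∈ deg2_A_QoriaV4phys_vlevR5K1910v_M) (hV : deg2_A_QoriaV4phys_vlevR5K1910v_Vz z ≤ deg2_A_QoriaV4phys_vlevR5K1910v_level) :
    deg2_A_QoriaV4phys_vlevR5K1910v_LVz z ≤ -deg2_A_QoriaV4phys_vlevR5K1910v_Wz z := by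
  have h := deg2_A_QoriaV4phys_vlevR5K1910v_Vdot_neg (z 0) (z 1) (z 2) hV (by have hb := deg2_A_QoriaV4phys_vlevR5K1910v_level_in_ball (z 0) (z 1) (z 2) hV hz; linarith) hz
  simp only [deg2_A_QoriaV4phys_vlevR5K1910v_LVz, deg2_A_QoriaV4phys_vlevR5K1910v_Wz]
  linarith

/-- `W = ε·φ` is positive definite: its only zero is the origin. [folklore] -/
theorem deg2_A_QoriaV4phys_vlevR5K1910v_eq_zero_of_Wz {z : Fin 3 → ℝ} (hW : deg2_A_QoriaV4phys_vlevR5K1910v_Wz z = 0) : z = 0 := by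
  simp only [deg2_A_QoriaV4phys_vlevR5K1910v_Wz] at hW
  have e0 : z 0 = 0 := by nlinarith [sq_nonneg (z 0), sq_nonneg (z 1), sq_nonneg (z 2)]
  have e1 : z 1 = 0 := by nlinarith [sq_nonneg (z 0), sq_nonneg (z 1), sq_nonneg (z 2)]
  have e2 : z 2 = 0 := by nlinarith [sq_nonneg (z 0), sq_nonneg (z 1), sq_nonneg (z 2)]
  funext i
  fin_cases i <;> simp [e0, e1, e2]

/-- Strictness on every level surface `{V = γ}`, `γ > 0`: `W > 0` there. [folklore] -/
theorem deg2_A_QoriaV4phys_vlevR5K1910v_Wz_pos {z : Fin 3 → ℝ} {γ : ℝ} (hγ0 : 0 < γ) (hV : deg2_A_QoriaV4phys_vlevR5K1910v_Vz z = γ) :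
    0 < deg2_A_QoriaV4phys_vlevR5K1910v_Wz z := by
  have hW0 : 0 ≤ deg2_A_QoriaV4phys_vlevR5K1910v_Wz z := by simp only [deg2_A_QoriaV4phys_vlevR5K1910v_Wz]; positivity
  rcases hW0.lt_or_eq with h | h
  · exact h
  · exfalso
    have hz0 := deg2_A_QoriaV4phys_vlevR5K1910v_eq_zero_of_Wz h.symm
    subst hz0
    simp [deg2_A_QoriaV4phys_vlevR5K1910v_Vz, deg2_A_QoriaV4phys_vlevR5K1910v_V_eq] at hV
    linarith

/-- Arc exclusion (A6) on the certified piece: `kappa ≤ 19/10` — the DECLARED arc bound of the V-LEVER object (★ #230 record: `κ ≤ 3/2`). CERTIFIED input: `deg2_A_QoriaV4phys_vlevR5K1910v_arc_excl`. [folklore] -/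
theorem deg2_A_QoriaV4phys_vlevR5K1910v_arc_kappa {z : Fin 3 → ℝ} (hz : z ∈ deg2_A_QoriaV4phys_vlevR5K1910v_M) (hV : deg2_A_QoriaV4phys_vlevR5K1910v_Vz z ≤ deg2_A_QoriaV4phys_vlevR5K1910v_level) :
    z 1 ≤ ((19 : ℝ) / 10) := by
  have h := deg2_A_QoriaV4phys_vlevR5K1910v_arc_excl (z 0) (z 1) (z 2) hV hz
  linarith

/-- Compactness of the certified piece `S = {z ∈ M | V z ≤ c}` (closed; bounded by
`level_in_ball`: `‖z‖∞ ≤ 150`). [folklore] -/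
theorem deg2_A_QoriaV4phys_vlevR5K1910v_isCompact_S : IsCompact {z ∈ deg2_A_QoriaV4phys_vlevR5K1910v_M | deg2_A_QoriaV4phys_vlevR5K1910v_Vz z ≤ deg2_A_QoriaV4phys_vlevR5K1910v_level} := by
  have hMc : IsClosed deg2_A_QoriaV4phys_vlevR5K1910v_M := by
    simp only [deg2_A_QoriaV4phys_vlevR5K1910v_M, deg2_A_QoriaV4phys_vlevR5K1910v_h_eq]
    exact isClosed_eq (by fun_prop) continuous_const
  have hVc : Continuous deg2_A_QoriaV4phys_vlevR5K1910v_Vz := by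
    unfold deg2_A_QoriaV4phys_vlevR5K1910v_Vz; simp only [deg2_A_QoriaV4phys_vlevR5K1910v_V_eq]; fun_prop
  have h := isCompact_sublevel_of_norm_le (D := univ) (c := deg2_A_QoriaV4phys_vlevR5K1910v_level) (R := (150 : ℝ)) hMc
    isClosed_univ hVc.continuousOn ?_
  · rwa [inter_univ] at h
  rintro z ⟨hz, -⟩ hV
  have hball := deg2_A_QoriaV4phys_vlevR5K1910v_level_in_ball (z 0) (z 1) (z 2) hV hz
  have hb0 : |z 0| ≤ (150 : ℝ) :=
    abs_le.2 (abs_le_of_sq_le_sq' (by nlinarith [sq_nonneg (z 1), sq_nonneg (z 2)]) (by norm_num))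
  have hb1 : |z 1| ≤ (150 : ℝ) :=
    abs_le.2 (abs_le_of_sq_le_sq' (by nlinarith [sq_nonneg (z 0), sq_nonneg (z 2)]) (by norm_num))
  have hb2 : |z 2| ≤ (150 : ℝ) :=
    abs_le.2 (abs_le_of_sq_le_sq' (by nlinarith [sq_nonneg (z 0), sq_nonneg (z 1)]) (by norm_num))
  refine (pi_norm_le_iff_of_nonneg (by norm_num)).2 fun i ↦ ?_
  rw [Real.norm_eq_abs]
  fin_cases i
  · simpa using hb0
  · simpa using hb1
  · simpa using hb2

/-! ### Calculus along a solution of the recast system -/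

/-- **Chain rule**: along a curve with right derivative `F (z t)`, `V ∘ z` has derivative
`LV (z t) = Vdot(z t)`. [folklore] -/
theorem deg2_A_QoriaV4phys_vlevR5K1910v_hasDerivWithinAt_Vz {z : ℝ → Fin 3 → ℝ} {t : ℝ} {s : Set ℝ}
    (hz : HasDerivWithinAt z (deg2_A_QoriaV4phys_vlevR5K1910v_F (z t)) s t) :
    HasDerivWithinAt (deg2_A_QoriaV4phys_vlevR5K1910v_Vz ∘ z) (deg2_A_QoriaV4phys_vlevR5K1910v_LVz (z t)) s t := by
  have h0 : HasDerivWithinAt (fun τ ↦ z τ 0) (deg2_A_QoriaV4phys_vlevR5K1910v_f_sigma (z t 0) (z t 1) (z t 2)) s t := by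
    simpa using (hasDerivWithinAt_pi.1 hz) 0
  have h1 : HasDerivWithinAt (fun τ ↦ z τ 1) (deg2_A_QoriaV4phys_vlevR5K1910v_f_kappa (z t 0) (z t 1) (z t 2)) s t := by
    simpa using (hasDerivWithinAt_pi.1 hz) 1
  have h2 : HasDerivWithinAt (fun τ ↦ z τ 2) (deg2_A_QoriaV4phys_vlevR5K1910v_f_omega (z t 0) (z t 1) (z t 2)) s t := by
    simpa using (hasDerivWithinAt_pi.1 hz) 2
  have heq : deg2_A_QoriaV4phys_vlevR5K1910v_Vz ∘ z = fun τ ↦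
      ((201677 : ℝ) / 500000) * (z τ 1) +
      ((171 : ℝ) / 1000000) * (z τ 2 ^ 2) +
      ((3 : ℝ) / 8000) * (z τ 1 * z τ 2) +
      ((74219 : ℝ) / 1000000) * (z τ 1 ^ 2) +
      ((1001 : ℝ) / 100000) * (z τ 0 * z τ 2) +
      ((11029 : ℝ) / 1000000) * (z τ 0 * z τ 1) := by
    funext τ; simp only [Function.comp_apply, deg2_A_QoriaV4phys_vlevR5K1910v_Vz]; linear_combination deg2_A_QoriaV4phys_vlevR5K1910v_V_eq (z τ 0) (z τ 1) (z τ 2)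
  rw [heq]
  refine (((((((h1.const_mul ((201677 : ℝ) / 500000))).fun_add
      ((h2.fun_pow 2).const_mul ((171 : ℝ) / 1000000))).fun_add
      ((h1.fun_mul h2).const_mul ((3 : ℝ) / 8000))).fun_add
      ((h1.fun_pow 2).const_mul ((74219 : ℝ) / 1000000))).fun_add
      ((h0.fun_mul h2).const_mul ((1001 : ℝ) / 100000))).fun_add
      ((h0.fun_mul h1).const_mul ((11029 : ℝ) / 1000000))).congr_deriv ?_
  simp only [deg2_A_QoriaV4phys_vlevR5K1910v_LVz, deg2_A_QoriaV4phys_vlevR5K1910v_Vdot_eq, deg2_A_QoriaV4phys_vlevR5K1910v_f_sigma_eq, deg2_A_QoriaV4phys_vlevR5K1910v_f_kappa_eq, deg2_A_QoriaV4phys_vlevR5K1910v_f_omega_eq]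
  push_cast
  ring

/-- **`deg2_A_QoriaV4phys_vlevR5K1910v_h` is a first integral** of the recast field: `deg2_A_QoriaV4phys_vlevR5K1910v_h ∘ z` has right derivative `0`.
[folklore] -/
theorem deg2_A_QoriaV4phys_vlevR5K1910v_hasDerivWithinAt_h {z : ℝ → Fin 3 → ℝ} {t : ℝ} {s : Set ℝ}
    (hz : HasDerivWithinAt z (deg2_A_QoriaV4phys_vlevR5K1910v_F (z t)) s t) :
    HasDerivWithinAt (fun τ ↦ deg2_A_QoriaV4phys_vlevR5K1910v_h (z τ 0) (z τ 1) (z τ 2)) 0 s t := by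
  have h0 : HasDerivWithinAt (fun τ ↦ z τ 0) (deg2_A_QoriaV4phys_vlevR5K1910v_f_sigma (z t 0) (z t 1) (z t 2)) s t := by
    simpa using (hasDerivWithinAt_pi.1 hz) 0
  have h1 : HasDerivWithinAt (fun τ ↦ z τ 1) (deg2_A_QoriaV4phys_vlevR5K1910v_f_kappa (z t 0) (z t 1) (z t 2)) s t := by
    simpa using (hasDerivWithinAt_pi.1 hz) 1
  have h2 : HasDerivWithinAt (fun τ ↦ z τ 2) (deg2_A_QoriaV4phys_vlevR5K1910v_f_omega (z t 0) (z t 1) (z t 2)) s t := by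
    simpa using (hasDerivWithinAt_pi.1 hz) 2
  have heq : (fun τ ↦ deg2_A_QoriaV4phys_vlevR5K1910v_h (z τ 0) (z τ 1) (z τ 2)) = fun τ ↦
      (-2 : ℝ) * (z τ 1) + (1 : ℝ) * (z τ 0 ^ 2) +
      (1 : ℝ) * (z τ 1 ^ 2) := by
    funext τ; linear_combination deg2_A_QoriaV4phys_vlevR5K1910v_h_eq (z τ 0) (z τ 1) (z τ 2)
  rw [heq]
  refine ((((h1.const_mul (-2 : ℝ))).fun_add
      ((h0.fun_pow 2).const_mul (1 : ℝ))).fun_add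
      ((h1.fun_pow 2).const_mul (1 : ℝ))).congr_deriv ?_
  simp only [deg2_A_QoriaV4phys_vlevR5K1910v_f_sigma_eq, deg2_A_QoriaV4phys_vlevR5K1910v_f_kappa_eq]
  push_cast
  ring

/-- A solution of the recast system starting on `M` stays on `M` (the constraints are first
integrals). [folklore] -/
theorem deg2_A_QoriaV4phys_vlevR5K1910v_mem_M {z : ℝ → Fin 3 → ℝ} (hzc : ContinuousOn z (Ici 0))
    (hz : ∀ t, 0 ≤ t → HasDerivWithinAt z (deg2_A_QoriaV4phys_vlevR5K1910v_F (z t)) (Ici t) t)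
    (h0 : z 0 ∈ deg2_A_QoriaV4phys_vlevR5K1910v_M) : ∀ t, 0 ≤ t → z t ∈ deg2_A_QoriaV4phys_vlevR5K1910v_M := by
  intro T hT
  have hc0 : ContinuousOn (fun τ ↦ deg2_A_QoriaV4phys_vlevR5K1910v_h (z τ 0) (z τ 1) (z τ 2)) (Icc 0 T) := by
    have hc : Continuous fun y : Fin 3 → ℝ ↦ deg2_A_QoriaV4phys_vlevR5K1910v_h (y 0) (y 1) (y 2) := by
      simp only [deg2_A_QoriaV4phys_vlevR5K1910v_h_eq]; fun_prop
    exact hc.comp_continuousOn (hzc.mono fun s hs ↦ hs.1)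
  have k0 := constant_of_has_deriv_right_zero hc0
    (fun t ht ↦ deg2_A_QoriaV4phys_vlevR5K1910v_hasDerivWithinAt_h (hz t ht.1)) T ⟨hT, le_rfl⟩
  have z0 : deg2_A_QoriaV4phys_vlevR5K1910v_h (z 0 0) (z 0 1) (z 0 2) = 0 := h0
  exact by show deg2_A_QoriaV4phys_vlevR5K1910v_h (z T 0) (z T 1) (z T 2) = 0; rw [k0, z0]

/-! ### The ROA inclusion for the recast model -/

/-- **G1-roa (recast coordinates).** MODELLED: the recast polynomial system `ż = F(z)` on
`{h = 0}` of the instance (model-1's `polyField`, interface I2; MODEL-VALIDITY row of the Bench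
file). CERTIFIED inputs: the kernel-checked identities of the Bench file. STATEMENT: for every level
`0 < γ ≤ c = 1` and every solution `z` on `[0, ∞)` (Mathlib sense: continuous, right derivative
`F (z t)`) with `z 0 ∈ M`, `V(z 0) ≤ γ`: `V(z t) ≤ γ` and the arc bounds for all `t ≥ 0`, and `z t → 0`.
Via `Lyapunov.certificate_invariance_tendsto_univ`. No sentence here says a machine or a grid is
stable. [folklore] -/
theorem deg2_A_QoriaV4phys_vlevR5K1910v_roa {γ : ℝ} (hγ0 : 0 < γ) (hγ : γ ≤ deg2_A_QoriaV4phys_vlevR5K1910v_level) {z : ℝ → Fin 3 → ℝ}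
    (hzc : ContinuousOn z (Ici 0))
    (hz : ∀ t, 0 ≤ t → HasDerivWithinAt z (deg2_A_QoriaV4phys_vlevR5K1910v_F (z t)) (Ici t) t)
    (h0M : z 0 ∈ deg2_A_QoriaV4phys_vlevR5K1910v_M) (h0V : deg2_A_QoriaV4phys_vlevR5K1910v_Vz (z 0) ≤ γ) :
    (∀ t, 0 ≤ t → deg2_A_QoriaV4phys_vlevR5K1910v_Vz (z t) ≤ γ ∧ z t 1 ≤ ((19 : ℝ) / 10)) ∧ Tendsto z atTop (𝓝 0) := by
  have hF : Continuous deg2_A_QoriaV4phys_vlevR5K1910v_F := by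
    refine continuous_pi fun i ↦ ?_
    fin_cases i <;> simp [deg2_A_QoriaV4phys_vlevR5K1910v_F, deg2_A_QoriaV4phys_vlevR5K1910v_f_sigma_eq, deg2_A_QoriaV4phys_vlevR5K1910v_f_kappa_eq, deg2_A_QoriaV4phys_vlevR5K1910v_f_omega_eq] <;> fun_prop
  have hV : Continuous deg2_A_QoriaV4phys_vlevR5K1910v_Vz := by unfold deg2_A_QoriaV4phys_vlevR5K1910v_Vz; simp only [deg2_A_QoriaV4phys_vlevR5K1910v_V_eq]; fun_prop
  have hW : Continuous deg2_A_QoriaV4phys_vlevR5K1910v_Wz := by unfold deg2_A_QoriaV4phys_vlevR5K1910v_Wz; fun_prop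
  have h0 : (0 : Fin 3 → ℝ) ∈ deg2_A_QoriaV4phys_vlevR5K1910v_M := by simp [deg2_A_QoriaV4phys_vlevR5K1910v_M, deg2_A_QoriaV4phys_vlevR5K1910v_h_eq]
  have hMc : IsClosed deg2_A_QoriaV4phys_vlevR5K1910v_M := by
    simp only [deg2_A_QoriaV4phys_vlevR5K1910v_M, deg2_A_QoriaV4phys_vlevR5K1910v_h_eq]
    exact isClosed_eq (by fun_prop) continuous_const
  have hSγ : IsCompact {y ∈ deg2_A_QoriaV4phys_vlevR5K1910v_M | deg2_A_QoriaV4phys_vlevR5K1910v_Vz y ≤ γ} :=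
    deg2_A_QoriaV4phys_vlevR5K1910v_isCompact_S.of_isClosed_subset (hMc.inter (isClosed_le hV continuous_const))
      (fun y hy ↦ ⟨hy.1, hy.2.trans hγ⟩)
  have h := certificate_invariance_tendsto_univ (M := deg2_A_QoriaV4phys_vlevR5K1910v_M) (LV := deg2_A_QoriaV4phys_vlevR5K1910v_LVz) (W := deg2_A_QoriaV4phys_vlevR5K1910v_Wz)
    (x₀ := 0) hSγ hF.continuousOn hV.continuousOn hW.continuousOn
    (fun y hy hVy ↦ deg2_A_QoriaV4phys_vlevR5K1910v_LVz_le hy (hVy.trans hγ))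
    (fun y _ _ ↦ by simp only [deg2_A_QoriaV4phys_vlevR5K1910v_Wz]; positivity)
    (fun y _ hVy ↦ deg2_A_QoriaV4phys_vlevR5K1910v_Wz_pos hγ0 hVy)
    h0 (by simp [deg2_A_QoriaV4phys_vlevR5K1910v_Vz, deg2_A_QoriaV4phys_vlevR5K1910v_V_eq]; exact hγ0.le) (by simp [deg2_A_QoriaV4phys_vlevR5K1910v_Wz])
    (fun y _ _ hWy ↦ deg2_A_QoriaV4phys_vlevR5K1910v_eq_zero_of_Wz hWy)
    hzc hz (fun t ht ↦ deg2_A_QoriaV4phys_vlevR5K1910v_hasDerivWithinAt_Vz (hz t ht)) (deg2_A_QoriaV4phys_vlevR5K1910v_mem_M hzc hz h0M) h0V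
  have hM := deg2_A_QoriaV4phys_vlevR5K1910v_mem_M hzc hz h0M
  exact ⟨fun t ht ↦ ⟨h.1 t ht, deg2_A_QoriaV4phys_vlevR5K1910v_arc_kappa (hM t ht) ((h.1 t ht).trans hγ)⟩, h.2⟩


/-! ### Back to the machine angle: original coordinates `x = (δ, ω)` via model-1's embedding -/

/-- The image of model-1's embedding `SMIB.embed δs` lies on the recast constraint set. [folklore] -/
theorem deg2_A_QoriaV4phys_vlevR5K1910v_embed_mem_M (δs : ℝ) (y : ℝ × ℝ) :
    (fun i : Fin 3 ↦ SMIB.embed δs y i) ∈ deg2_A_QoriaV4phys_vlevR5K1910v_M := by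
  show deg2_A_QoriaV4phys_vlevR5K1910v_h (SMIB.embed δs y ((0 : Fin 3) : ℕ)) (SMIB.embed δs y ((1 : Fin 3) : ℕ))
    (SMIB.embed δs y ((2 : Fin 3) : ℕ)) = 0
  simp only [Fin.val_zero, Fin.val_one, SMIB.embed_zero, SMIB.embed_one, deg2_A_QoriaV4phys_vlevR5K1910v_h_eq]
  nlinarith [sin_sq_add_cos_sq (y.1 - δs)]

/-- **Exact embedding (model-1's chain rule, re-read in the Bench vocabulary).** Along a solution
of the SMIB model `p` whose recast data are the certificate's rationals
(`a = 233605208200/1873666673`, `b = 29431488000/1873666673`, `d = 33`, PARTITION A1′) and whose equilibrium angle is `δs`,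
the recast curve `t ↦ (sin u, 1 − cos u, ω)` solves `ż = F(z)` with the Bench field.
[folklore] -/
theorem deg2_A_QoriaV4phys_vlevR5K1910v_hasDerivWithinAt_embed (p : SMIB) {δs : ℝ} (hM : p.M ≠ 0)
    (ha : ((233605208200/1873666673 : ℚ) : ℝ) = p.PM * cos (δs - p.γ) / p.M)
    (hb : ((29431488000/1873666673 : ℚ) : ℝ) = p.PM * sin (δs - p.γ) / p.M)
    (hd : ((33 : ℚ) : ℝ) = p.D / p.M) (hP : p.IsEquilibrium δs)
    {x : ℝ → ℝ × ℝ} {s : Set ℝ} (hx : p.IsSolutionOn x s) {t : ℝ} (ht : t ∈ s) :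
    HasDerivWithinAt (fun τ ↦ fun i : Fin 3 ↦ SMIB.embed δs (x τ) i)
      (deg2_A_QoriaV4phys_vlevR5K1910v_F (fun i : Fin 3 ↦ SMIB.embed δs (x t) i)) s t := by
  refine hasDerivWithinAt_pi.2 fun i ↦ ?_
  have h := p.hasDerivWithinAt_embed hM ha hb hd hP hx ht i
  refine h.congr_deriv ?_
  fin_cases i <;>
    simp [SMIB.polyField, SMIB.fσ, SMIB.fκ, SMIB.fω, deg2_A_QoriaV4phys_vlevR5K1910v_F, deg2_A_QoriaV4phys_vlevR5K1910v_f_sigma_eq, deg2_A_QoriaV4phys_vlevR5K1910v_f_kappa_eq,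
      deg2_A_QoriaV4phys_vlevR5K1910v_f_omega_eq, Poly.eval_cons, Poly.eval_nil, Monomial.eval_eq, Monomial.evalFrom_cons,
      Monomial.evalFrom_nil, SMIB.embed, vars_cons_zero, vars_cons_succ] <;> ring

/-- **G1.SMIB-roa in original coordinates, with angle recovery (A6).** MODELLED: the classical
SMIB model `M_smib` of Anderson–Fouad (2.40)–(2.42) (+ damping, Sauer–Pai (5.157)) as typed by
model-1 (`SMIB.field`, `SMIB.IsSolutionOn`), for ANY parameter record `p` and equilibrium angle
`δs` satisfying the A1′ data relations of the certified instance (`a = P_M c*/M = 233605208200/1873666673`,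
`b = P_M s*/M = 29431488000/1873666673`, `d = D/M = 33`; instance of record SMIB-K13post-D10 = Kundur 1994
Ex. 13 post-fault plant, `P_m′` per A1′, `K_D = 10`, MV-1). CERTIFIED inputs: the four kernel-checked
identities of the Bench file. STATEMENT: for every `0 < γ ≤ 1` and every solution
`x = (δ, ω)` on `[0, ∞)` with `V(sin u₀, 1 − cos u₀, ω₀) ≤ γ` and `|u₀| < π` (`u = δ − δs`): for all
`t ≥ 0`, `V ≤ γ` along the recast state and `|u t| < π` (the relative angle never reaches `±π`:
no pole slip), and `(δ t, ω t) → (δs, 0)`. No sentence here says a machine or a grid is stable.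
[folklore] -/
theorem deg2_A_QoriaV4phys_vlevR5K1910v_smib_roa (p : SMIB) {δs : ℝ} (hM : p.M ≠ 0)
    (ha : ((233605208200/1873666673 : ℚ) : ℝ) = p.PM * cos (δs - p.γ) / p.M)
    (hb : ((29431488000/1873666673 : ℚ) : ℝ) = p.PM * sin (δs - p.γ) / p.M)
    (hd : ((33 : ℚ) : ℝ) = p.D / p.M) (hP : p.IsEquilibrium δs)
    {γ : ℝ} (hγ0 : 0 < γ) (hγ : γ ≤ deg2_A_QoriaV4phys_vlevR5K1910v_level) {x : ℝ → ℝ × ℝ} (hx : p.IsSolutionOn x (Ici 0))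
    (h0V : deg2_A_QoriaV4phys_vlevR5K1910v_V (sin ((x 0).1 - δs)) (1 - cos ((x 0).1 - δs)) (x 0).2 ≤ γ)
    (h0win : |(x 0).1 - δs| < π) :
    (∀ t, 0 ≤ t → deg2_A_QoriaV4phys_vlevR5K1910v_V (sin ((x t).1 - δs)) (1 - cos ((x t).1 - δs)) (x t).2 ≤ γ ∧
      |(x t).1 - δs| < π) ∧ Tendsto x atTop (𝓝 (δs, 0)) := by
  set z : ℝ → Fin 3 → ℝ := fun τ i ↦ SMIB.embed δs (x τ) i with hzdef
  have hxc : ContinuousOn x (Ici 0) := fun t ht ↦ (hx t ht).continuousWithinAt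
  have hzc : ContinuousOn z (Ici 0) := by
    have hc : Continuous fun y : ℝ × ℝ ↦ fun i : Fin 3 ↦ SMIB.embed δs y i := by
      refine continuous_pi fun i ↦ ?_
      fin_cases i <;> simp [SMIB.embed] <;> fun_prop
    exact hc.comp_continuousOn hxc
  have hz : ∀ t, 0 ≤ t → HasDerivWithinAt z (deg2_A_QoriaV4phys_vlevR5K1910v_F (z t)) (Ici t) t := fun t ht ↦
    (deg2_A_QoriaV4phys_vlevR5K1910v_hasDerivWithinAt_embed p hM ha hb hd hP hx ht).mono (Ici_subset_Ici.2 ht)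
  have h0M : z 0 ∈ deg2_A_QoriaV4phys_vlevR5K1910v_M := deg2_A_QoriaV4phys_vlevR5K1910v_embed_mem_M δs (x 0)
  have h0V' : deg2_A_QoriaV4phys_vlevR5K1910v_Vz (z 0) ≤ γ := by simpa [hzdef, deg2_A_QoriaV4phys_vlevR5K1910v_Vz] using h0V
  obtain ⟨hinv, hlim⟩ := deg2_A_QoriaV4phys_vlevR5K1910v_roa hγ0 hγ hzc hz h0M h0V'
  have hV : ∀ t, 0 ≤ t → deg2_A_QoriaV4phys_vlevR5K1910v_V (sin ((x t).1 - δs)) (1 - cos ((x t).1 - δs)) (x t).2 ≤ γ :=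
    fun t ht ↦ by simpa [hzdef, deg2_A_QoriaV4phys_vlevR5K1910v_Vz] using (hinv t ht).1
  -- no pole slip: `κ ≤ 19/10` on the certified piece gives `cos u ≥ -9/10 > -1`
  have hcos : ∀ t, 0 ≤ t → -1 < cos ((x t).1 - δs) := by
    intro t ht
    have hk := (hinv t ht).2
    simp only [hzdef, Fin.val_one, SMIB.embed_one] at hk
    linarith
  have huc : ContinuousOn (fun t ↦ (x t).1 - δs) (Ici 0) :=
    (continuous_fst.comp_continuousOn hxc).sub continuousOn_const
  have hwin := abs_lt_pi_of_neg_one_lt_cos huc h0win hcos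
  have hκ : Tendsto (fun t ↦ 1 - cos ((x t).1 - δs)) atTop (𝓝 0) := by
    simpa [hzdef] using tendsto_pi_nhds.1 hlim 1
  have hω : Tendsto (fun t ↦ (x t).2) atTop (𝓝 0) := by
    simpa [hzdef] using tendsto_pi_nhds.1 hlim 2
  have hu : Tendsto (fun t ↦ (x t).1 - δs) atTop (𝓝 0) :=
    tendsto_zero_of_one_sub_cos_tendsto hwin hκ
  have hδ : Tendsto (fun t ↦ (x t).1) atTop (𝓝 δs) := by
    have h := hu.add_const δs
    simpa using h
  refine ⟨fun t ht ↦ ⟨hV t ht, hwin t ht⟩, ?_⟩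
  have h := hδ.prodMk_nhds hω
  simpa using h

end

end Summit.Ventures.GridStability.Bench.GFMSMIB
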